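import Literature.NumberTheory.Transcendental.KZCalculusProofs
import Mathlib.Analysis.SpecialFunctions.Pow.Real

/-!
# `VolumeFormOffPlane` (stmt-KontsevichZagierPeriods-14935) — line `Sketch`,
stub `stub_simplexPairs` (the mixed simplex/box sector in dimension `n + 2`, pair form)

From (1) the generic splitter of an integrand-`1` representation along a finite disjoint union of
domains (`[r] − ∑ [R i] ∈ relations` together with additivity of the values) and (2) the family
form of the mixed simplex/box sector (two mixed finite families of log-boxes and log-simplices in
dimension `n + 2` with equal total value are KZ-equivalent as formal sums) we derive the PAIR FORM
of the sector: two integrand-`1` representations whose domains are finite disjoint unions of such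
log-boxes and log-simplices and whose values agree are KZ-equivalent.

Proof (bookkeeping only): merge the boxes and the simplices of one side into a single family
indexed by `Fin (k + m)` (`Fin.append`), split `r` along it by (1), likewise `r'`; the total values
of the two merged families then agree because `r.value = r'.value`, so (2) applies, and
`[r] − [r'] = ([r] − Σ) + (Σ − Σ') − ([r'] − Σ')`.

Sources: Kontsevich–Zagier 2001, §1.2 (the moves of the calculus).
-/

noncomputable section

open MeasureTheory Set
open Literature.NumberTheory.Transcendental

namespace Summit.KontsevichZagierPeriods.SymplecticScissors.LogPolytope

/-! ## Merging two disjoint finite families into one -/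

/-- **Merging two disjoint families.** If the domain of the integrand-`1` representation `r` is
the disjoint union of the domains of the integrand-`1` families `rB` (indexed by `Fin k`) and `rS`
(indexed by `Fin m`), then, granted the generic splitter along finite disjoint unions,
`[r] − (∑ [rB i] + ∑ [rS ν])` is a relation and the values add up (merge the two families into one
family indexed by `Fin (k + m)` through `Fin.append`, then `Fin.sum_univ_add`). [folklore] -/
theorem spr_side
    (hSplit : ∀ (N k : ℕ) (r : KZ.IntegralRep N) (R : Fin k → KZ.IntegralRep N),
      r.domain = ⋃ i, (R i).domain → (∀ i j, i ≠ j → Disjoint (R i).domain (R j).domain) →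
      (∀ p ∈ r.domain, r.integrand p = 1) → (∀ i, ∀ p ∈ (R i).domain, (R i).integrand p = 1) →
      KZ.of r - ∑ i, KZ.of (R i) ∈ KZ.relations ∧ r.value = ∑ i, (R i).value)
    {N k m : ℕ} (r : KZ.IntegralRep N) (rB : Fin k → KZ.IntegralRep N)
    (rS : Fin m → KZ.IntegralRep N)
    (hrd : r.domain = (⋃ i, (rB i).domain) ∪ (⋃ ν, (rS ν).domain))
    (hdB : ∀ i j, i ≠ j → Disjoint (rB i).domain (rB j).domain)
    (hdS : ∀ ν μ, ν ≠ μ → Disjoint (rS ν).domain (rS μ).domain)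
    (hdBS : ∀ i ν, Disjoint (rB i).domain (rS ν).domain)
    (hr : ∀ p ∈ r.domain, r.integrand p = 1)
    (hrBi : ∀ i, ∀ p ∈ (rB i).domain, (rB i).integrand p = 1)
    (hrSi : ∀ ν, ∀ p ∈ (rS ν).domain, (rS ν).integrand p = 1) :
    KZ.of r - (∑ i, KZ.of (rB i) + ∑ ν, KZ.of (rS ν)) ∈ KZ.relations ∧
      r.value = ∑ i, (rB i).value + ∑ ν, (rS ν).value := by
  -- adapted from `toric_sector_pairs` (helper F) and `mxs_side` (MixedSector) of this line
  have hdom : r.domain = ⋃ i, (Fin.append rB rS i).domain := by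
    rw [hrd]
    ext p
    simp only [mem_union, mem_iUnion]
    constructor
    · rintro (⟨i, hi⟩ | ⟨ν, hν⟩)
      · exact ⟨Fin.castAdd m i, by rwa [Fin.append_left]⟩
      · exact ⟨Fin.natAdd k ν, by rwa [Fin.append_right]⟩
    · rintro ⟨i, hi⟩
      induction i using Fin.addCases with
      | left i => exact Or.inl ⟨i, by rwa [Fin.append_left] at hi⟩
      | right ν => exact Or.inr ⟨ν, by rwa [Fin.append_right] at hi⟩
  have hdisj : ∀ i j, i ≠ j →
      Disjoint (Fin.append rB rS i).domain (Fin.append rB rS j).domain := by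
    intro i j hij
    induction i using Fin.addCases with
    | left i =>
      induction j using Fin.addCases with
      | left j =>
        rw [Fin.append_left, Fin.append_left]
        exact hdB i j fun h => hij (by rw [h])
      | right μ =>
        rw [Fin.append_left, Fin.append_right]
        exact hdBS i μ
    | right ν =>
      induction j using Fin.addCases with
      | left j =>
        rw [Fin.append_right, Fin.append_left]
        exact (hdBS j ν).symm
      | right μ =>
        rw [Fin.append_right, Fin.append_right]
        exact hdS ν μ fun h => hij (by rw [h])
  have hone : ∀ i, ∀ p ∈ (Fin.append rB rS i).domain, (Fin.append rB rS i).integrand p = 1 := by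
    intro i
    induction i using Fin.addCases with
    | left i => rw [Fin.append_left]; exact hrBi i
    | right ν => rw [Fin.append_right]; exact hrSi ν
  obtain ⟨hrel, hval⟩ := hSplit N (k + m) r (Fin.append rB rS) hdom hdisj hr hone
  simp only [Fin.sum_univ_add, Fin.append_left, Fin.append_right] at hrel hval
  exact ⟨hrel, hval⟩

/-! ## The stub -/

/-- **Stub (the mixed simplex/box sector in dimension `n + 2`, pair form; bookkeeping).** Granted
(1) the generic splitter of an integrand-`1` representation along a finite disjoint union and
(2) the family form of the mixed simplex/box sector: for `α, β > 0` real algebraic and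
multiplicatively independent, two integrand-`1` representations of dimension `n + 2` whose domains
are finite disjoint unions of log-boxes (real-algebraic position, edge ratios in `α^ℚ β^ℚ`, `> 1`)
and log-simplices (`c = (∏ aᵢ)·αᵘ βᵛ`, ratio `> 1`) and whose values agree are KZ-equivalent
(merge boxes and simplices of each side into one family, split both representations by (1), apply
(2), and recombine `[r] − [r'] = ([r] − Σ) + (Σ − Σ') − ([r'] − Σ')`). [folklore] -/
theorem stub_simplexPairs : (∀ (N k : ℕ) (r : KZ.IntegralRep N) (R : Fin k → KZ.IntegralRep N), r.domain = ⋃ i, (R i).domain → (∀ i j, i ≠ j → Disjoint (R i).domain (R j).domain) → (∀ p ∈ r.domain, r.integrand p = 1) → (∀ i, ∀ p ∈ (R i).domain, (R i).integrand p = 1) → KZ.of r - ∑ i, KZ.of (R i) ∈ KZ.relations ∧ r.value = ∑ i, (R i).value) → (∀ (n : ℕ) (α β : ℝ), 0 < α → 0 < β → IsAlgebraic ℚ α → IsAlgebraic ℚ β → (∀ p q : ℤ, α ^ p * β ^ q = 1 → p = 0 ∧ q = 0) → ∀ (k m k' m' : ℕ) (a : Fin k → Fin (n + 1) → ℝ)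 (u v : Fin k → Fin (n + 1) → ℚ) (sa : Fin m → Fin (n + 1) → ℝ) (sc : Fin m → ℝ) (su sv : Fin m → ℚ) (a' : Fin k' → Fin (n + 1) → ℝ) (u' v' : Fin k' → Fin (n + 1) → ℚ) (sa' : Fin m' → Fin (n + 1) → ℝ) (sc' : Fin m' → ℝ) (su' sv' : Fin m' → ℚ) (rB : Fin k → KZ.IntegralRep (n + 1 + 1)) (rS : Fin m → KZ.IntegralRep (n + 1 + 1)) (rB' : Fin k' → KZ.IntegralRep (n + 1 + 1)) (rS' : Fin m' → KZ.IntegralRep (n + 1 + 1)), (∀ i j, 0 < a i j) → (∀ i j, IsAlgebraic ℚ (a i j)) → (∀ i j, 1 < α ^ ((u i j : ℚ) : ℝ) * β ^ ((v i j : ℚ) : ℝ)) → (∀ i, (rB i).domain = {p : Fin (n + 1 + 1) → ℝ | (∀ j : Fin (n + 1), a i j < p (Fin.castSucc j) ∧ p (Fin.castSucc j) < a i j * (α ^ ((u i j : ℚ) : ℝ) * β ^ ((v i j : ℚ) : ℝ))) ∧ 0 < p (Fin.last (n + 1)) ∧ p (Fin.last (n + 1)) * ∏ j : Fin (n + 1),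 p (Fin.castSucc j) < 1}) → (∀ i, ∀ p ∈ (rB i).domain, (rB i).integrand p = 1) → (∀ ν ι, 0 < sa ν ι) → (∀ ν ι, IsAlgebraic ℚ (sa ν ι)) → (∀ ν, IsAlgebraic ℚ (sc ν)) → (∀ ν, sc ν = (∏ ι, sa ν ι) * (α ^ ((su ν : ℚ) : ℝ) * β ^ ((sv ν : ℚ) : ℝ))) → (∀ ν, 1 < α ^ ((su ν : ℚ) : ℝ) * β ^ ((sv ν : ℚ) : ℝ)) → (∀ ν, (rS ν).domain = {p : Fin ((n + 1) + 1) → ℝ | (∀ ι : Fin (n + 1), (sa ν) ι < p (Fin.castSucc ι)) ∧ ∏ ι : Fin (n + 1), p (Fin.castSucc ι) < sc ν ∧ 0 < p (Fin.last (n + 1)) ∧ p (Fin.last (n + 1)) * ∏ ι : Fin (n + 1), p (Fin.castSucc ι) < 1}) → (∀ ν, ∀ p ∈ (rS ν).domain, (rS ν).integrand p = 1) → (∀ i j, 0 < a' i j) → (∀ i j, IsAlgebraic ℚ (a' i j)) → (∀ i j, 1 < α ^ ((u' i j : ℚ) : ℝ) * β ^ ((v' i j : ℚ) : ℝ)) →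 (∀ i, (rB' i).domain = {p : Fin (n + 1 + 1) → ℝ | (∀ j : Fin (n + 1), a' i j < p (Fin.castSucc j) ∧ p (Fin.castSucc j) < a' i j * (α ^ ((u' i j : ℚ) : ℝ) * β ^ ((v' i j : ℚ) : ℝ))) ∧ 0 < p (Fin.last (n + 1)) ∧ p (Fin.last (n + 1)) * ∏ j : Fin (n + 1), p (Fin.castSucc j) < 1}) → (∀ i, ∀ p ∈ (rB' i).domain, (rB' i).integrand p = 1) → (∀ ν ι, 0 < sa' ν ι) → (∀ ν ι, IsAlgebraic ℚ (sa' ν ι)) → (∀ ν, IsAlgebraic ℚ (sc' ν)) → (∀ ν, sc' ν = (∏ ι, sa' ν ι) * (α ^ ((su' ν : ℚ) : ℝ) * β ^ ((sv' ν : ℚ) : ℝ))) → (∀ ν, 1 < α ^ ((su' ν : ℚ) : ℝ) * β ^ ((sv' ν : ℚ) : ℝ)) → (∀ ν, (rS' ν).domain = {p : Fin ((n + 1) + 1) → ℝ | (∀ ι : Fin (n + 1), (sa' ν) ι < p (Fin.castSucc ι)) ∧ ∏ ι : Fin (n + 1), p (Fin.castSucc ι) < sc' ν ∧ 0 < p (Fin.last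 (n + 1)) ∧ p (Fin.last (n + 1)) * ∏ ι : Fin (n + 1), p (Fin.castSucc ι) < 1}) → (∀ ν, ∀ p ∈ (rS' ν).domain, (rS' ν).integrand p = 1) → ∑ ν, (rB ν).value + ∑ ν, (rS ν).value = ∑ ν, (rB' ν).value + ∑ ν, (rS' ν).value → (∑ ν, KZ.of (rB ν) + ∑ ν, KZ.of (rS ν)) - (∑ ν, KZ.of (rB' ν) + ∑ ν, KZ.of (rS' ν)) ∈ KZ.relations) → (∀ (n : ℕ) (α β : ℝ), 0 < α → 0 < β → IsAlgebraic ℚ α → IsAlgebraic ℚ β → (∀ p q : ℤ, α ^ p * β ^ q = 1 → p = 0 ∧ q = 0) → ∀ (k m k' m' : ℕ) (a : Fin k → Fin (n + 1) → ℝ) (u v : Fin k → Fin (n + 1) → ℚ) (sa : Fin m → Fin (n + 1) → ℝ) (sc : Fin m → ℝ) (su sv : Fin m → ℚ) (a' : Fin k' → Fin (n + 1) → ℝ) (u' v' : Fin k' → Fin (n + 1) → ℚ) (sa' : Fin m' → Fin (n + 1) → ℝ) (sc' : Fin m' → ℝ) (su' sv' : Fin m' → ℚ) (rB : Fin k → KZ.IntegralRep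 (n + 1 + 1)) (rS : Fin m → KZ.IntegralRep (n + 1 + 1)) (rB' : Fin k' → KZ.IntegralRep (n + 1 + 1)) (rS' : Fin m' → KZ.IntegralRep (n + 1 + 1)) (r r' : KZ.IntegralRep (n + 1 + 1)), (∀ i j, 0 < a i j) → (∀ i j, IsAlgebraic ℚ (a i j)) → (∀ i j, 1 < α ^ ((u i j : ℚ) : ℝ) * β ^ ((v i j : ℚ) : ℝ)) → (∀ i, (rB i).domain = {p : Fin (n + 1 + 1) → ℝ | (∀ j : Fin (n + 1), a i j < p (Fin.castSucc j) ∧ p (Fin.castSucc j) < a i j * (α ^ ((u i j : ℚ) : ℝ) * β ^ ((v i j : ℚ) : ℝ))) ∧ 0 < p (Fin.last (n + 1)) ∧ p (Fin.last (n + 1)) * ∏ j : Fin (n + 1), p (Fin.castSucc j) < 1}) → (∀ i, ∀ p ∈ (rB i).domain, (rB i).integrand p = 1) → (∀ ν ι, 0 < sa ν ι) → (∀ ν ι, IsAlgebraic ℚ (sa ν ι)) → (∀ ν, IsAlgebraic ℚ (sc ν)) → (∀ ν, sc ν = (∏ ι, sa ν ι) * (α ^ ((su ν : ℚ) : ℝ)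 * β ^ ((sv ν : ℚ) : ℝ))) → (∀ ν, 1 < α ^ ((su ν : ℚ) : ℝ) * β ^ ((sv ν : ℚ) : ℝ)) → (∀ ν, (rS ν).domain = {p : Fin ((n + 1) + 1) → ℝ | (∀ ι : Fin (n + 1), (sa ν) ι < p (Fin.castSucc ι)) ∧ ∏ ι : Fin (n + 1), p (Fin.castSucc ι) < sc ν ∧ 0 < p (Fin.last (n + 1)) ∧ p (Fin.last (n + 1)) * ∏ ι : Fin (n + 1), p (Fin.castSucc ι) < 1}) → (∀ ν, ∀ p ∈ (rS ν).domain, (rS ν).integrand p = 1) → (∀ i j, 0 < a' i j) → (∀ i j, IsAlgebraic ℚ (a' i j)) → (∀ i j, 1 < α ^ ((u' i j : ℚ) : ℝ) * β ^ ((v' i j : ℚ) : ℝ)) → (∀ i, (rB' i).domain = {p : Fin (n + 1 + 1) → ℝ | (∀ j : Fin (n + 1), a' i j < p (Fin.castSucc j) ∧ p (Fin.castSucc j) < a' i j * (α ^ ((u' i j : ℚ) : ℝ) * β ^ ((v' i j : ℚ) : ℝ))) ∧ 0 < p (Fin.last (n + 1)) ∧ p (Fin.last (n + 1)) * ∏ j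 : Fin (n + 1), p (Fin.castSucc j) < 1}) → (∀ i, ∀ p ∈ (rB' i).domain, (rB' i).integrand p = 1) → (∀ ν ι, 0 < sa' ν ι) → (∀ ν ι, IsAlgebraic ℚ (sa' ν ι)) → (∀ ν, IsAlgebraic ℚ (sc' ν)) → (∀ ν, sc' ν = (∏ ι, sa' ν ι) * (α ^ ((su' ν : ℚ) : ℝ) * β ^ ((sv' ν : ℚ) : ℝ))) → (∀ ν, 1 < α ^ ((su' ν : ℚ) : ℝ) * β ^ ((sv' ν : ℚ) : ℝ)) → (∀ ν, (rS' ν).domain = {p : Fin ((n + 1) + 1) → ℝ | (∀ ι : Fin (n + 1), (sa' ν) ι < p (Fin.castSucc ι)) ∧ ∏ ι : Fin (n + 1), p (Fin.castSucc ι) < sc' ν ∧ 0 < p (Fin.last (n + 1)) ∧ p (Fin.last (n + 1)) * ∏ ι : Fin (n + 1), p (Fin.castSucc ι) < 1}) → (∀ ν, ∀ p ∈ (rS' ν).domain, (rS' ν).integrand p = 1) → r.domain = (⋃ i, (rB i).domain) ∪ (⋃ ν, (rS ν).domain) → (∀ i j, i ≠ j → Disjoint ((rB) i).domain ((rB) j).domain)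 → (∀ ν μ, ν ≠ μ → Disjoint ((rS) ν).domain ((rS) μ).domain) → (∀ i ν, Disjoint ((rB) i).domain ((rS) ν).domain) → (∀ p ∈ r.domain, r.integrand p = 1) → r'.domain = (⋃ i, (rB' i).domain) ∪ (⋃ ν, (rS' ν).domain) → (∀ i j, i ≠ j → Disjoint ((rB') i).domain ((rB') j).domain) → (∀ ν μ, ν ≠ μ → Disjoint ((rS') ν).domain ((rS') μ).domain) → (∀ i ν, Disjoint ((rB') i).domain ((rS') ν).domain) → (∀ p ∈ r'.domain, r'.integrand p = 1) → r.value = r'.value → KZ.Equivalent r r') := by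
  intro hSplit hMixed n α β hα hβ hαa hβa hind k m k' m' a u v sa sc su sv a' u' v' sa' sc' su' sv'
    rB rS rB' rS' r r' ha haa hlt hrBd hrBi hsa hsaa hsca hsc hltS hrSd hrSi ha' ha'a hlt' hrB'd
    hrB'i hsa' hsa'a hsc'a hsc' hltS' hrS'd hrS'i hrd hdB hdS hdBS hr hrd' hdB' hdS' hdBS' hr' hv
  obtain ⟨h₁, hv₁⟩ := spr_side hSplit r rB rS hrd hdB hdS hdBS hr hrBi hrSi
  obtain ⟨h₂, hv₂⟩ := spr_side hSplit r' rB' rS' hrd' hdB' hdS' hdBS' hr' hrB'i hrS'i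
  have h₃ : (∑ ν, KZ.of (rB ν) + ∑ ν, KZ.of (rS ν)) -
      (∑ ν, KZ.of (rB' ν) + ∑ ν, KZ.of (rS' ν)) ∈ KZ.relations :=
    hMixed n α β hα hβ hαa hβa hind k m k' m' a u v sa sc su sv a' u' v' sa' sc' su' sv' rB rS
      rB' rS' ha haa hlt hrBd hrBi hsa hsaa hsca hsc hltS hrSd hrSi ha' ha'a hlt' hrB'd hrB'i hsa'
      hsa'a hsc'a hsc' hltS' hrS'd hrS'i (by rw [← hv₁, ← hv₂, hv])
  have key : KZ.of r - KZ.of r' =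
      (KZ.of r - (∑ ν, KZ.of (rB ν) + ∑ ν, KZ.of (rS ν))) +
        ((∑ ν, KZ.of (rB ν) + ∑ ν, KZ.of (rS ν)) - (∑ ν, KZ.of (rB' ν) + ∑ ν, KZ.of (rS' ν))) -
        (KZ.of r' - (∑ ν, KZ.of (rB' ν) + ∑ ν, KZ.of (rS' ν))) := by
    abel
  show KZ.of r - KZ.of r' ∈ KZ.relations
  rw [key]
  exact KZ.relations.sub_mem (KZ.relations.add_mem h₁ h₃) h₂

end Summit.KontsevichZagierPeriods.SymplecticScissors.LogPolytope

end
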